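import Literature.AnabelianGeometry.SemiGraphs.PiPresentationBridge
import HarnessLib

/-!
# Anabelioids: branch-type subgroups of `π₁(B(G), β)` are conjugates of `range φ` ([SemiAnbd] Def. 2.1)

Mochizuki, *Semi-graphs of anabelioids*, Publ. RIMS **42** (2006), Def. 2.1 pp. 23–24
[cite: MochizukiSemiAnbd2006, Def. 2.1 pp.23-24]: "the image of `Π_b` in `Π_v`, which is
well-defined up to conjugation in `Π_v`".  In the profinite-group model: for profinite `G`, ANY
basepoint (fibre functor) `F` of `B(G)`, a continuous `φ : H → G` of profinite groups, ANY basepoint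
`F_e` of `B(H)` and ANY transport `α : res φ ⋙ F_e ≅ F`, the subgroup of `Aut F` obtained by
transporting `π₁(res φ)(Aut F_e)` along `α` is carried, by one isomorphism `θ : Aut F ≃* G`
depending only on `F`, to a conjugate `x · range φ · x⁻¹` (`exists_mulEquiv_forall_range_conj`).
Ingredients: uniqueness of fibre functors up to isomorphism (`FiberFunctorUnique.lean`) and
`π₁(B(G)) = G` (`BCatFundamentalGroup.lean`); the element `x` is the automorphism of the forgetful
basepoint given by the loop `forget_G = res φ ⋙ forget_H ≅ res φ ⋙ F_e ≅ F ≅ forget_G`.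
Consumer: the §2/§3 presentation bridge for aloof / estranged edges.  Proof-only file.
-/

noncomputable section

namespace Literature.AnabelianGeometry.Anabelioids

open CategoryTheory CategoryTheory.Limits CategoryTheory.PreGaloisCategory
open Literature.AlgebraicGeometry.Frobenioids (BCat)
open scoped FintypeCatDiscrete Pointwise

universe u

/-- Components of `Aut.autMulEquivOfIso`. [folklore] -/
private theorem autMulEquivOfIso_hom_app {C : Type*} [Category C] {D : Type*} [Category D]
    {P Q : C ⥤ D} (h : P ≅ Q) (x : Aut P) (X : C) :
    (Aut.autMulEquivOfIso h x).hom.app X = h.inv.app X ≫ x.hom.app X ≫ h.hom.app X := rfl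

/-- `conjAut` along `e.symm` undoes `conjAut` along `e`. [folklore] -/
private theorem conjAut_symm_conjAut {C : Type*} [Category C] {X Y : C} (e : X ≅ Y) (f : Aut X) :
    e.symm.conjAut (e.conjAut f) = f := by
  rw [Iso.conjAut_apply, Iso.conjAut_apply]
  ext
  simp

/-- **Branch-type subgroups are conjugates of `range φ`** (Def. 2.1, "well-defined up to
conjugation"): see the module docstring. [cite: MochizukiSemiAnbd2006, Def. 2.1 pp.23-24] -/
theorem exists_mulEquiv_forall_range_conj (G : Type u) [Group G] [TopologicalSpace G]
    [IsTopologicalGroup G] [CompactSpace G] [TotallyDisconnectedSpace G]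
    (F : BCat G ⥤ FintypeCat.{u}) (hF : letI := galoisCategory_bCat G; FiberFunctor F) :
    ∃ θ : Aut F ≃* G,
      ∀ (H : Type u) [Group H] [TopologicalSpace H] [IsTopologicalGroup H] [CompactSpace H]
        [TotallyDisconnectedSpace H] (φ : H →ₜ* G) (Fe : BCat H ⥤ FintypeCat.{u})
        (_ : letI := galoisCategory_bCat H; FiberFunctor Fe)
        (α : ContAction.res FintypeCat.{u} φ ⋙ Fe ≅ F),
        ∃ x : G,
          (((Aut.autMulEquivOfIso α).toMonoidHom.comp
              (pi1Map (ContAction.res FintypeCat.{u} φ) Fe)).range).map θ.toMonoidHom =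
            ConjAct.toConjAct x • φ.toMonoidHom.range := by
  letI := galoisCategory_bCat G
  haveI := hF
  haveI := fiberFunctor_forget_bCat G
  obtain ⟨κ⟩ := nonempty_iso_of_fiberFunctor F
    (ObjectProperty.ι (Action.IsContinuous (V := FintypeCat.{u}) (G := G)) ⋙
      Action.forget FintypeCat.{u} G)
  obtain ⟨eV, heV⟩ := exists_continuousMulEquiv_aut_forget (G := G)
  refine ⟨κ.conjAut.trans eV.toMulEquiv.symm, ?_⟩
  intro H _ _ _ _ _ φ Fe hFe α
  letI := galoisCategory_bCat H
  haveI := hFe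
  haveI := fiberFunctor_forget_bCat H
  obtain ⟨lam⟩ := nonempty_iso_of_fiberFunctor Fe
    (ObjectProperty.ι (Action.IsContinuous (V := FintypeCat.{u}) (G := H)) ⋙
      Action.forget FintypeCat.{u} H)
  obtain ⟨eE, heE⟩ := exists_continuousMulEquiv_aut_forget (G := H)
  -- the loop `forget_G = res φ ⋙ forget_H ≅ res φ ⋙ F_e ≅ F ≅ forget_G`
  let μ : Aut (ObjectProperty.ι (Action.IsContinuous (V := FintypeCat.{u}) (G := G)) ⋙
      Action.forget FintypeCat.{u} G) :=
    (Functor.isoWhiskerLeft (ContAction.res FintypeCat.{u} φ) lam).symm ≪≫ α ≪≫ κ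
  have hμh : ∀ X : BCat G, μ.hom.app X =
      lam.inv.app ((ContAction.res FintypeCat.{u} φ).obj X) ≫ α.hom.app X ≫ κ.hom.app X :=
    fun X => rfl
  have hμi : ∀ X : BCat G, μ.inv.app X =
      κ.inv.app X ≫ α.inv.app X ≫ lam.hom.app ((ContAction.res FintypeCat.{u} φ).obj X) := by
    intro X
    change (κ.inv ≫ α.inv ≫ _).app X = _
    rfl
  let x : G := eV.symm μ
  have hx : eV x = μ := eV.apply_symm_apply μ
  refine ⟨x, ?_⟩
  -- key computation
  have key : ∀ y : H,
      (κ.conjAut.trans eV.toMulEquiv.symm)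
        (Aut.autMulEquivOfIso α (pi1Map (ContAction.res FintypeCat.{u} φ) Fe
          (lam.symm.conjAut (eE y)))) = x * φ y * x⁻¹ := by
    intro y
    apply eV.injective
    change eV (eV.symm (κ.conjAut _)) = _
    rw [eV.apply_symm_apply, map_mul, map_mul, map_inv, hx]
    apply aut_forget_eq_of_app_eq
    intro X
    rw [Iso.conjAut_apply]
    simp only [Aut.Aut_mul_def, Aut.Aut_inv_def, Iso.trans_hom, Iso.symm_hom,
      NatTrans.comp_app, autMulEquivOfIso_hom_app, pi1Map_hom_app, hμh, hμi, heV,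
      Category.assoc]
    rw [Iso.conjAut_apply]
    simp only [Iso.trans_hom, Iso.symm_hom, Iso.symm_symm_eq, NatTrans.comp_app, heE]
    rfl
  have hsurj : ∀ τ : Aut Fe, ∃ y : H, lam.symm.conjAut (eE y) = τ := fun τ =>
    ⟨eE.symm (lam.conjAut τ), by rw [eE.apply_symm_apply, conjAut_symm_conjAut]⟩
  ext z
  constructor
  · rintro ⟨σ, ⟨τ, rfl⟩, rfl⟩
    obtain ⟨y, rfl⟩ := hsurj τ
    rw [MulEquiv.coe_toMonoidHom, MonoidHom.comp_apply, MulEquiv.coe_toMonoidHom, key,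
      Subgroup.mem_smul_pointwise_iff_exists]
    exact ⟨φ y, ⟨y, rfl⟩, by rw [ConjAct.smul_def, ConjAct.ofConjAct_toConjAct]⟩
  · intro hz
    rw [Subgroup.mem_smul_pointwise_iff_exists] at hz
    obtain ⟨_, ⟨y, rfl⟩, rfl⟩ := hz
    refine ⟨Aut.autMulEquivOfIso α (pi1Map (ContAction.res FintypeCat.{u} φ) Fe
      (lam.symm.conjAut (eE y))), ⟨_, rfl⟩, ?_⟩
    rw [MulEquiv.coe_toMonoidHom, key, ConjAct.smul_def, ConjAct.ofConjAct_toConjAct]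
    rfl

/-! ### Topological version (appended): `θ` as an isomorphism of topological groups -/

/-- Conjugation by an isomorphism of fibre functors is continuous (it acts coordinatewise on
`∏_X Aut (F X)`). [cite: MochizukiGeoAn2004, §1.1 p.10] -/
theorem continuous_conjAut_of_iso {C : Type*} [Category C] [GaloisCategory C]
    {F F' : C ⥤ FintypeCat.{u}} [FiberFunctor F] [FiberFunctor F'] (e : F ≅ F') :
    Continuous e.conjAut := by
  rw [(autEmbedding_isClosedEmbedding F').isInducing.continuous_iff, continuous_pi_iff]
  intro X
  have hco : (fun σ : Aut F => autEmbedding F' (e.conjAut σ) X) =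
      fun σ => (e.app X).conjAut (autEmbedding F σ X) := by
    funext σ
    refine Iso.ext ?_
    simp [Iso.conj_apply, autEmbedding_apply]
  rw [show (autEmbedding F' ∘ e.conjAut) = fun σ => autEmbedding F' (e.conjAut σ) from rfl]
  change Continuous fun σ : Aut F => autEmbedding F' (e.conjAut σ) X
  rw [hco]
  exact continuous_of_discreteTopology.comp
    ((continuous_apply X).comp (autEmbedding_isClosedEmbedding F).continuous)

/-- **Branch-type subgroups are conjugates of `range φ`**, topological form: the identification
`θ : Aut F ≃ₜ* G` may be taken to be an isomorphism of TOPOLOGICAL groups (so that openness /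
closedness statements transfer as well). [cite: MochizukiSemiAnbd2006, Def. 2.1 pp.23-24] -/
theorem exists_continuousMulEquiv_forall_range_conj (G : Type u) [Group G] [TopologicalSpace G]
    [IsTopologicalGroup G] [CompactSpace G] [TotallyDisconnectedSpace G]
    (F : BCat G ⥤ FintypeCat.{u}) (hF : letI := galoisCategory_bCat G; FiberFunctor F) :
    ∃ θ : Aut F ≃ₜ* G,
      ∀ (H : Type u) [Group H] [TopologicalSpace H] [IsTopologicalGroup H] [CompactSpace H]
        [TotallyDisconnectedSpace H] (φ : H →ₜ* G) (Fe : BCat H ⥤ FintypeCat.{u})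
        (_ : letI := galoisCategory_bCat H; FiberFunctor Fe)
        (α : ContAction.res FintypeCat.{u} φ ⋙ Fe ≅ F),
        ∃ x : G,
          (((Aut.autMulEquivOfIso α).toMonoidHom.comp
              (pi1Map (ContAction.res FintypeCat.{u} φ) Fe)).range).map θ.toMonoidHom =
            ConjAct.toConjAct x • φ.toMonoidHom.range := by
  letI := galoisCategory_bCat G
  haveI := hF
  haveI := fiberFunctor_forget_bCat G
  obtain ⟨κ⟩ := nonempty_iso_of_fiberFunctor F
    (ObjectProperty.ι (Action.IsContinuous (V := FintypeCat.{u}) (G := G)) ⋙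
      Action.forget FintypeCat.{u} G)
  obtain ⟨eV, heV⟩ := exists_continuousMulEquiv_aut_forget (G := G)
  -- the topological identification
  have hcont : Continuous (κ.conjAut.trans eV.toMulEquiv.symm) :=
    eV.symm.continuous.comp (continuous_conjAut_of_iso κ)
  let θ : Aut F ≃ₜ* G :=
    { κ.conjAut.trans eV.toMulEquiv.symm with
      continuous_toFun := hcont
      continuous_invFun := Continuous.continuous_symm_of_equiv_compact_to_t2
        (f := (κ.conjAut.trans eV.toMulEquiv.symm).toEquiv) hcont }
  refine ⟨θ, ?_⟩
  intro H _ _ _ _ _ φ Fe hFe α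
  letI := galoisCategory_bCat H
  haveI := hFe
  haveI := fiberFunctor_forget_bCat H
  obtain ⟨lam⟩ := nonempty_iso_of_fiberFunctor Fe
    (ObjectProperty.ι (Action.IsContinuous (V := FintypeCat.{u}) (G := H)) ⋙
      Action.forget FintypeCat.{u} H)
  obtain ⟨eE, heE⟩ := exists_continuousMulEquiv_aut_forget (G := H)
  let μ : Aut (ObjectProperty.ι (Action.IsContinuous (V := FintypeCat.{u}) (G := G)) ⋙
      Action.forget FintypeCat.{u} G) :=
    (Functor.isoWhiskerLeft (ContAction.res FintypeCat.{u} φ) lam).symm ≪≫ α ≪≫ κ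
  have hμh : ∀ X : BCat G, μ.hom.app X =
      lam.inv.app ((ContAction.res FintypeCat.{u} φ).obj X) ≫ α.hom.app X ≫ κ.hom.app X :=
    fun X => rfl
  have hμi : ∀ X : BCat G, μ.inv.app X =
      κ.inv.app X ≫ α.inv.app X ≫ lam.hom.app ((ContAction.res FintypeCat.{u} φ).obj X) := by
    intro X
    change (κ.inv ≫ α.inv ≫ _).app X = _
    rfl
  let x : G := eV.symm μ
  have hx : eV x = μ := eV.apply_symm_apply μ
  refine ⟨x, ?_⟩
  have key : ∀ y : H,
      θ (Aut.autMulEquivOfIso α (pi1Map (ContAction.res FintypeCat.{u} φ) Fe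
          (lam.symm.conjAut (eE y)))) = x * φ y * x⁻¹ := by
    intro y
    apply eV.injective
    change eV (eV.symm (κ.conjAut _)) = _
    rw [eV.apply_symm_apply, map_mul, map_mul, map_inv, hx]
    apply aut_forget_eq_of_app_eq
    intro X
    rw [Iso.conjAut_apply]
    simp only [Aut.Aut_mul_def, Aut.Aut_inv_def, Iso.trans_hom, Iso.symm_hom,
      NatTrans.comp_app, autMulEquivOfIso_hom_app, pi1Map_hom_app, hμh, hμi, heV,
      Category.assoc]
    rw [Iso.conjAut_apply]
    simp only [Iso.trans_hom, Iso.symm_hom, Iso.symm_symm_eq, NatTrans.comp_app, heE]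
    rfl
  have hsurj : ∀ τ : Aut Fe, ∃ y : H, lam.symm.conjAut (eE y) = τ := fun τ =>
    ⟨eE.symm (lam.conjAut τ), by rw [eE.apply_symm_apply, conjAut_symm_conjAut]⟩
  ext z
  constructor
  · rintro ⟨σ, ⟨τ, rfl⟩, rfl⟩
    obtain ⟨y, rfl⟩ := hsurj τ
    change θ (Aut.autMulEquivOfIso α (pi1Map (ContAction.res FintypeCat.{u} φ) Fe
      (lam.symm.conjAut (eE y)))) ∈ _
    rw [key, Subgroup.mem_smul_pointwise_iff_exists]
    exact ⟨φ y, ⟨y, rfl⟩, by rw [ConjAct.smul_def, ConjAct.ofConjAct_toConjAct]⟩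
  · intro hz
    rw [Subgroup.mem_smul_pointwise_iff_exists] at hz
    obtain ⟨_, ⟨y, rfl⟩, rfl⟩ := hz
    refine ⟨Aut.autMulEquivOfIso α (pi1Map (ContAction.res FintypeCat.{u} φ) Fe
      (lam.symm.conjAut (eE y))), ⟨_, rfl⟩, ?_⟩
    change θ (Aut.autMulEquivOfIso α (pi1Map (ContAction.res FintypeCat.{u} φ) Fe
      (lam.symm.conjAut (eE y)))) = _
    rw [key, ConjAct.smul_def, ConjAct.ofConjAct_toConjAct]
    rfl

/-! ### The commutative square (appended): `π₁(res φ)` IS `φ` up to the identifications and an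
inner automorphism -/

/-- **`π₁(res φ) = φ` up to conjugation, at arbitrary basepoints**: for profinite `G`, `H`,
`φ : H → G` continuous, basepoints `F` of `B(G)` and `F_e` of `B(H)` and a transport
`α : res φ ⋙ F_e ≅ F`, there are topological identifications `θ : Aut F ≃ₜ* G`,
`θ_e : Aut F_e ≃ₜ* H` and `x ∈ G` with `θ (α ⋆ π₁(res φ)(τ)) = x · φ (θ_e τ) · x⁻¹` for all
`τ ∈ Aut F_e` ([SemiAnbd] Def. 2.1 p. 23: `Π_b → Π_v` "well-defined up to conjugation"; [GeoAn]
Def. 1.1.2 (ii)).  Here `θ` depends only on `F` (it is the `θ` of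
`exists_continuousMulEquiv_forall_range_conj`'s proof shape). [cite: MochizukiSemiAnbd2006, Def. 2.1 pp.23-24] -/
theorem exists_continuousMulEquiv_square (G : Type u) [Group G] [TopologicalSpace G]
    [IsTopologicalGroup G] [CompactSpace G] [TotallyDisconnectedSpace G]
    (F : BCat G ⥤ FintypeCat.{u}) (hF : letI := galoisCategory_bCat G; FiberFunctor F) :
    ∃ θ : Aut F ≃ₜ* G,
      ∀ (H : Type u) [Group H] [TopologicalSpace H] [IsTopologicalGroup H] [CompactSpace H]
        [TotallyDisconnectedSpace H] (φ : H →ₜ* G) (Fe : BCat H ⥤ FintypeCat.{u})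
        (_ : letI := galoisCategory_bCat H; FiberFunctor Fe)
        (α : ContAction.res FintypeCat.{u} φ ⋙ Fe ≅ F),
        ∃ (θe : Aut Fe ≃ₜ* H) (x : G), ∀ τ : Aut Fe,
          θ (Aut.autMulEquivOfIso α (pi1Map (ContAction.res FintypeCat.{u} φ) Fe τ)) =
            x * φ (θe τ) * x⁻¹ := by
  letI := galoisCategory_bCat G
  haveI := hF
  haveI := fiberFunctor_forget_bCat G
  obtain ⟨κ⟩ := nonempty_iso_of_fiberFunctor F
    (ObjectProperty.ι (Action.IsContinuous (V := FintypeCat.{u}) (G := G)) ⋙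
      Action.forget FintypeCat.{u} G)
  obtain ⟨eV, heV⟩ := exists_continuousMulEquiv_aut_forget (G := G)
  have hcont : Continuous (κ.conjAut.trans eV.toMulEquiv.symm) :=
    eV.symm.continuous.comp (continuous_conjAut_of_iso κ)
  let θ : Aut F ≃ₜ* G :=
    { κ.conjAut.trans eV.toMulEquiv.symm with
      continuous_toFun := hcont
      continuous_invFun := Continuous.continuous_symm_of_equiv_compact_to_t2
        (f := (κ.conjAut.trans eV.toMulEquiv.symm).toEquiv) hcont }
  refine ⟨θ, ?_⟩
  intro H _ _ _ _ _ φ Fe hFe α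
  letI := galoisCategory_bCat H
  haveI := hFe
  haveI := fiberFunctor_forget_bCat H
  obtain ⟨lam⟩ := nonempty_iso_of_fiberFunctor Fe
    (ObjectProperty.ι (Action.IsContinuous (V := FintypeCat.{u}) (G := H)) ⋙
      Action.forget FintypeCat.{u} H)
  obtain ⟨eE, heE⟩ := exists_continuousMulEquiv_aut_forget (G := H)
  -- the identification of `Aut F_e` with `H`: conjugate by `λ`, then `π₁(B(H)) = H`
  have hconte : Continuous (lam.conjAut.trans eE.toMulEquiv.symm) :=
    eE.symm.continuous.comp (continuous_conjAut_of_iso lam)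
  let θe : Aut Fe ≃ₜ* H :=
    { lam.conjAut.trans eE.toMulEquiv.symm with
      continuous_toFun := hconte
      continuous_invFun := Continuous.continuous_symm_of_equiv_compact_to_t2
        (f := (lam.conjAut.trans eE.toMulEquiv.symm).toEquiv) hconte }
  let μ : Aut (ObjectProperty.ι (Action.IsContinuous (V := FintypeCat.{u}) (G := G)) ⋙
      Action.forget FintypeCat.{u} G) :=
    (Functor.isoWhiskerLeft (ContAction.res FintypeCat.{u} φ) lam).symm ≪≫ α ≪≫ κ
  have hμh : ∀ X : BCat G, μ.hom.app X =
      lam.inv.app ((ContAction.res FintypeCat.{u} φ).obj X) ≫ α.hom.app X ≫ κ.hom.app X :=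
    fun X => rfl
  have hμi : ∀ X : BCat G, μ.inv.app X =
      κ.inv.app X ≫ α.inv.app X ≫ lam.hom.app ((ContAction.res FintypeCat.{u} φ).obj X) := by
    intro X
    change (κ.inv ≫ α.inv ≫ _).app X = _
    rfl
  let x : G := eV.symm μ
  have hx : eV x = μ := eV.apply_symm_apply μ
  refine ⟨θe, x, fun τ => ?_⟩
  -- write `τ = λ⁻¹-conjugate of e_E y` with `y = θe τ`
  have hτ : lam.symm.conjAut (eE (θe τ)) = τ := by
    change lam.symm.conjAut (eE (eE.symm (lam.conjAut τ))) = τ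
    rw [eE.apply_symm_apply, conjAut_symm_conjAut]
  conv_lhs => rw [← hτ]
  apply eV.injective
  change eV (eV.symm (κ.conjAut _)) = _
  rw [eV.apply_symm_apply, map_mul, map_mul, map_inv, hx]
  apply aut_forget_eq_of_app_eq
  intro X
  rw [Iso.conjAut_apply]
  simp only [Aut.Aut_mul_def, Aut.Aut_inv_def, Iso.trans_hom, Iso.symm_hom,
    NatTrans.comp_app, autMulEquivOfIso_hom_app, pi1Map_hom_app, hμh, hμi, heV,
    Category.assoc]
  rw [Iso.conjAut_apply]
  simp only [Iso.trans_hom, Iso.symm_hom, Iso.symm_symm_eq, NatTrans.comp_app, heE]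
  rfl

/-! ### Kernel form (appended): `ker π₁(res φ) = θe⁻¹(ker φ)` with `θe` depending only on the
basepoint of `B(H)` -/

/-- **Kernel of `π₁(res φ)` at an arbitrary basepoint**: for profinite `H` and a basepoint `F_e`
of `B(H)` there is a topological identification `θe : Aut F_e ≃ₜ* H` (depending only on `F_e`)
such that for EVERY profinite `G` and continuous `φ : H → G`, an automorphism `τ` of `F_e` is
killed by `π₁(res φ)` iff `φ (θe τ) = 1` — the kernel statement behind "the kernel of `Π_c → F_c`
acts trivially" in [SemiAnbd] Def. 2.3 (iii) (splitting of coverings by approximators).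
[cite: MochizukiSemiAnbd2006, Def 2.3(iii) p.25] -/
theorem exists_continuousMulEquiv_ker (H : Type u) [Group H] [TopologicalSpace H]
    [IsTopologicalGroup H] [CompactSpace H] [TotallyDisconnectedSpace H]
    (Fe : BCat H ⥤ FintypeCat.{u}) (hFe : letI := galoisCategory_bCat H; FiberFunctor Fe) :
    ∃ θe : Aut Fe ≃ₜ* H,
      ∀ (G : Type u) [Group G] [TopologicalSpace G] [IsTopologicalGroup G] [CompactSpace G]
        [TotallyDisconnectedSpace G] (φ : H →ₜ* G) (τ : Aut Fe),
        pi1Map (ContAction.res FintypeCat.{u} φ) Fe τ = 1 ↔ φ (θe τ) = 1 := by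
  letI := galoisCategory_bCat H
  haveI := hFe
  haveI := fiberFunctor_forget_bCat H
  obtain ⟨lam⟩ := nonempty_iso_of_fiberFunctor Fe
    (ObjectProperty.ι (Action.IsContinuous (V := FintypeCat.{u}) (G := H)) ⋙
      Action.forget FintypeCat.{u} H)
  obtain ⟨eE, heE⟩ := exists_continuousMulEquiv_aut_forget (G := H)
  have hconte : Continuous (lam.conjAut.trans eE.toMulEquiv.symm) :=
    eE.symm.continuous.comp (continuous_conjAut_of_iso lam)
  let θe : Aut Fe ≃ₜ* H :=
    { lam.conjAut.trans eE.toMulEquiv.symm with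
      continuous_toFun := hconte
      continuous_invFun := Continuous.continuous_symm_of_equiv_compact_to_t2
        (f := (lam.conjAut.trans eE.toMulEquiv.symm).toEquiv) hconte }
  refine ⟨θe, ?_⟩
  intro G _ _ _ _ _ φ τ
  letI := galoisCategory_bCat G
  obtain ⟨eG, heG⟩ := exists_continuousMulEquiv_aut_forget (G := G)
  -- write `τ = λ⁻¹-conjugate of e_E y` with `y = θe τ`
  have hτ : lam.symm.conjAut (eE (θe τ)) = τ := by
    change lam.symm.conjAut (eE (eE.symm (lam.conjAut τ))) = τ
    rw [eE.apply_symm_apply, conjAut_symm_conjAut]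
  -- components of `π₁(res φ) τ` after conjugating back by `λ`: `ρ_X(φ y)`
  have happ : ∀ X : BCat G,
      (pi1Map (ContAction.res FintypeCat.{u} φ) Fe τ).hom.app X =
        lam.hom.app ((ContAction.res FintypeCat.{u} φ).obj X) ≫ X.obj.ρ (φ (θe τ)) ≫
          lam.inv.app ((ContAction.res FintypeCat.{u} φ).obj X) := by
    intro X
    conv_lhs => rw [← hτ]
    rw [pi1Map_hom_app, Iso.conjAut_apply]
    simp only [Iso.trans_hom, Iso.symm_hom, Iso.symm_symm_eq, NatTrans.comp_app, heE]
    rfl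
  constructor
  · intro h1
    -- `φ y` acts trivially on every finite `G`-set, hence is `1` (`π₁(B(G)) = G` is injective)
    apply eG.injective
    rw [map_one]
    apply aut_forget_eq_of_app_eq
    intro X
    rw [heG]
    apply FintypeCat.hom_ext
    intro x
    change X.obj.V at x
    change (X.obj.ρ (φ (θe τ))).hom x = x
    have hX := congrArg (fun ν : Aut (ContAction.res FintypeCat.{u} φ ⋙ Fe) => ν.hom.app X) h1
    rw [happ X] at hX
    -- evaluate at `λ⁻¹ x`
    have h3 := ConcreteCategory.congr_hom hX
      ((lam.inv.app ((ContAction.res FintypeCat.{u} φ).obj X)).hom x)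
    change (lam.inv.app ((ContAction.res FintypeCat.{u} φ).obj X)).hom
        ((X.obj.ρ (φ (θe τ))).hom
          ((lam.hom.app ((ContAction.res FintypeCat.{u} φ).obj X)).hom
            ((lam.inv.app ((ContAction.res FintypeCat.{u} φ).obj X)).hom x))) =
      (lam.inv.app ((ContAction.res FintypeCat.{u} φ).obj X)).hom x at h3
    have h4 : (lam.hom.app ((ContAction.res FintypeCat.{u} φ).obj X)).hom
        ((lam.inv.app ((ContAction.res FintypeCat.{u} φ).obj X)).hom x) = x :=
      ConcreteCategory.congr_hom (lam.inv_hom_id_app ((ContAction.res FintypeCat.{u} φ).obj X)) x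
    rw [h4] at h3
    -- `λ⁻¹` is injective (`λ ∘ λ⁻¹ = id`)
    have h5 := congrArg (fun z => (lam.hom.app ((ContAction.res FintypeCat.{u} φ).obj X)).hom z) h3
    have h6 : ∀ z, (lam.hom.app ((ContAction.res FintypeCat.{u} φ).obj X)).hom
        ((lam.inv.app ((ContAction.res FintypeCat.{u} φ).obj X)).hom z) = z :=
      fun z => ConcreteCategory.congr_hom
        (lam.inv_hom_id_app ((ContAction.res FintypeCat.{u} φ).obj X)) z
    simp only [h6] at h5
    exact h5
  · intro h1
    apply Iso.ext
    apply NatTrans.ext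
    funext X
    rw [happ X, h1, map_one]
    change lam.hom.app _ ≫ 𝟙 _ ≫ lam.inv.app _ = 𝟙 _
    rw [Category.id_comp, Iso.hom_inv_id_app]

end Literature.AnabelianGeometry.Anabelioids

end
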